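import Literature.Topology.FourManifolds.MMSWPictureGluing
import HarnessLib

/-!
# Local sections of the model identification, I: points off the cores

Topic `Literature/Topology/FourManifolds`; part of the proof of the named fact
`Literature.Topology.FourManifolds.pictureSurgeryPresentation` (`MMSWPictureSurgery.lean`; Kirby,
*The Topology of 4-Manifolds*, LNM 1374 (1989), Ch. I §2, Lemma 2.1).  Everything here is proved;
no named fact is introduced.

For the gluing data `G : Gluing k η Y` we construct, about the image `G.map p` of every point
`p = (z, w)` of `M_k ∖ K` OFF the cores (`w ≠ 0`), an open set `N ∋ G.map p` of `Y` and a smooth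
map `sec : Y → ℂ × ℂ` with `sec '' N ⊆ M_k ∖ K` and `G.map ∘ sec = id` on `N`.  Consequently
`N ⊆ G.map '' (M_k ∖ K)` and `sec` is the inverse of `G.map` there.  Three kinds of points:

* `z` in the inner annulus about `c_j`: `sec = (Θᴮ_j)⁻¹ ∘ (chartZ, conj ∘ dir ∘ chartC) ∘ σ_N ∘ JA⁻¹`
  (`secNear`);
* `z` in the far zone with the latitude in the band: the same with the outer straightening map
  in the latitude coordinate (`secFar`);
* `z` of potential `< 1 − 3η/2` (no compression nearby): `sec` = the chart lift of the standard
  picture (`secLow`).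

## References

* R. Kirby, *The Topology of 4-Manifolds*, LNM 1374 (1989), Ch. I §2. [Kirby1989]
-/

open scoped Manifold ContDiff Topology Real ComplexConjugate
open Function Set Metric

noncomputable section

namespace Literature.Topology.FourManifolds

/-- Local notation: `𝔼 n` is the model Euclidean space `EuclideanSpace ℝ (Fin n)`. -/
local notation "𝔼 " n:arg => EuclideanSpace ℝ (Fin n)
/-- Local notation: `𝕊 n` is the unit sphere of `EuclideanSpace ℝ (Fin (n + 1))`. -/
local notation "𝕊 " n:arg => (Metric.sphere (0 : EuclideanSpace ℝ (Fin (n + 1))) 1)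

namespace MMSW

open Literature.AlgebraicTopology.Homotopy.HopfFibration (zC wC)

variable {k : ℕ} {η : ℝ}

/-! ## Readings of chart points -/

/-- The direction of the planar chart coordinate. [folklore] -/
def dirC (y : (ℝ × ℝ) × ℝ) : ℂ := unitDir 0 (chartC y)

/-- `chartC` is real-linear, hence smooth. [folklore] -/
theorem contDiff_chartC : ContDiff ℝ ∞ chartC := by
  unfold chartC
  exact (Complex.ofRealCLM.contDiff.comp (contDiff_fst.comp contDiff_fst)).add
    ((Complex.ofRealCLM.contDiff.comp (contDiff_snd.comp contDiff_fst)).mul contDiff_const)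

/-- `chartZ` is smooth off the axis. [folklore] -/
theorem contDiffAt_chartZ {y : (ℝ × ℝ) × ℝ} (hy : chartC y ≠ 0) : ContDiffAt ℝ ∞ (chartZ k) y := by
  unfold chartZ
  have h1 : ContDiffAt ℝ ∞ (fun y : (ℝ × ℝ) × ℝ ↦ ‖chartC y‖ - drawRadius k) y :=
    (contDiff_chartC.contDiffAt.norm ℝ hy).sub contDiffAt_const
  exact (Complex.ofRealCLM.contDiff.comp_contDiffAt y h1).add
    ((Complex.ofRealCLM.contDiff.comp contDiff_snd).contDiffAt.mul contDiffAt_const)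

/-- `dirC` is smooth off the axis. [folklore] -/
theorem contDiffAt_dirC {y : (ℝ × ℝ) × ℝ} (hy : chartC y ≠ 0) : ContDiffAt ℝ ∞ dirC y :=
  (contDiffAt_unitDir hy).comp y contDiff_chartC.contDiffAt

/-- `|dirC| = 1` off the axis. [folklore] -/
theorem norm_dirC {y : (ℝ × ℝ) × ℝ} (hy : chartC y ≠ 0) : ‖dirC y‖ = 1 := norm_unitDir hy

/-- **Reconstruction**: a chart point off the axis is the chart point of its `z`-reading seen from
its direction. [folklore] -/
theorem cpt_chartZ_dirC (y : (ℝ × ℝ) × ℝ) : cpt k (chartZ k y) (dirC y) = y := by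
  have h : (((chartZ k y).re + drawRadius k : ℝ) : ℂ) * dirC y = chartC y := by
    rw [chartZ_re, sub_add_cancel, dirC]
    have := norm_mul_unitDir 0 (chartC y)
    simp only [sub_zero] at this
    exact this
  simp only [cpt, h, chartC_re, chartC_im, chartZ_im]

/-- The `z`-reading of the virtual chart point of a point of `M_k` off the cores is the virtual
planar point. [folklore] -/
theorem chartZ_virtC (hη : 0 < η) (hη' : η ≤ 1 / 40) {p : ℂ × ℂ} (hp : p ∈ Mset k) (hw : p.2 ≠ 0) :
    chartZ k (virtC k η p) = zmod k η p :=
  chartZ_cpt (by rw [Complex.norm_conj, norm_unitDir hw]) (re_zmod_add_drawRadius_pos hη hη' hp hw).le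

/-- The planar coordinate of the virtual chart point of a point of `M_k` off the cores is nonzero.
[folklore] -/
theorem chartC_virtC_ne_zero (hη : 0 < η) (hη' : η ≤ 1 / 40) {p : ℂ × ℂ} (hp : p ∈ Mset k)
    (hw : p.2 ≠ 0) : chartC (virtC k η p) ≠ 0 := by
  rw [virtC, chartC_cpt]
  refine mul_ne_zero (by exact_mod_cast (re_zmod_add_drawRadius_pos hη hη' hp hw).ne') ?_
  rw [map_ne_zero_iff _ (RingHom.injective _), ← norm_ne_zero_iff, norm_unitDir hw]
  exact one_ne_zero

/-- The direction of the virtual chart point of a point of `M_k` off the cores is `conj (w/|w|)`.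
[folklore] -/
theorem dirC_virtC (hη : 0 < η) (hη' : η ≤ 1 / 40) {p : ℂ × ℂ} (hp : p ∈ Mset k) (hw : p.2 ≠ 0) :
    dirC (virtC k η p) = conj (unitDir 0 p.2) := by
  rw [dirC, virtC, chartC_cpt]
  have h := unitDir_ray (c := (0 : ℂ)) (v := conj (unitDir 0 p.2))
    (by rw [Complex.norm_conj, norm_unitDir hw]) (re_zmod_add_drawRadius_pos hη hη' hp hw)
  rwa [zero_add] at h

/-! ## The chart reading of a point of `Y` -/

section Readings

variable {Y : Type*} [TopologicalSpace Y] [ChartedSpace (𝔼 3) Y] (G : Gluing k η Y)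

namespace Gluing

/-- The chart reading `σ_N (JA⁻¹ y)`. [folklore] -/
def rd (y : Y) : (ℝ × ℝ) × ℝ := stereoNorthCoords ((G.JAinv y : 𝕊 3) : 𝔼 4)

/-- The open set of points of `JA '' LC` whose preimage is off the north pole. [folklore] -/
def domRd : Set Y := G.JA '' G.LC ∩ G.JAinv ⁻¹' {a | a ≠ northPole}

/-- `domRd` is open. [folklore] -/
theorem isOpen_domRd : IsOpen G.domRd :=
  G.JAinv_smooth.continuousOn.isOpen_inter_preimage (G.JA_open _ G.isOpen_LC subset_rfl) isOpen_ne

/-- The chart reading is smooth on `domRd`. [folklore] -/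
theorem contMDiffOn_rd : ContMDiffOn (𝓡 3) 𝓘(ℝ, (ℝ × ℝ) × ℝ) ∞ G.rd G.domRd := by
  haveI : Fact (Module.finrank ℝ (𝔼 4) = 3 + 1) := ⟨finrank_euclideanSpace_fin⟩
  intro y hy
  have h1 : ContMDiffAt (𝓡 3) (𝓡 3) ∞ G.JAinv y :=
    G.JAinv_smooth.contMDiffAt ((G.JA_open _ G.isOpen_LC subset_rfl).mem_nhds hy.1)
  have h2 : ContMDiffAt (𝓡 3) 𝓘(ℝ, (ℝ × ℝ) × ℝ) ∞ (fun a : 𝕊 3 ↦ stereoNorthCoords (a : 𝔼 4))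
      (G.JAinv y) :=
    (contDiffAt_stereoNorthCoords (apply_three_ne_one_of_ne_northPole hy.2)).contMDiffAt.comp _
      contMDiff_coe_sphere.contMDiffAt
  exact (h2.comp y h1).contMDiffWithinAt

/-- At the image of a point of `M_k ∖ K` off the cores the reading is the virtual chart point.
[folklore] -/
theorem rd_map {p : ℂ × ℂ} (hp : p ∈ G.Sset) (hw : p.2 ≠ 0) :
    G.map p ∈ G.domRd ∧ G.JAinv (G.map p) = virtS k η p ∧ G.rd (G.map p) = virtC k η p := by
  have hmem := G.virt_mem p hp.1 hp.2 hw
  rw [G.map_eq_of_ne_zero hw]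
  have hinv : G.JAinv (G.JA (virtS k η p)) = virtS k η p := G.JAinv_JA _ hmem
  refine ⟨⟨⟨_, hmem, rfl⟩, ?_⟩, hinv, ?_⟩
  · show G.JAinv (G.JA (virtS k η p)) ≠ northPole
    rw [hinv]; exact stereoNorthInv_ne_northPole _
  · rw [rd, hinv, coe_virtS, stereoNorthCoords_stereoNorthInvCoe]

/-- A section candidate `x'` of `M_k` off the cores whose virtual chart point is the reading of
`y ∈ domRd` lies in `M_k ∖ K` and maps to `y`. [folklore] -/
theorem map_eq_of_virtC_eq_rd {y : Y} (hy : y ∈ G.domRd) {x : ℂ × ℂ} (hx : x ∈ Mset k)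
    (hw : x.2 ≠ 0) (hv : virtC k η x = G.rd y) : x ∈ G.Sset ∧ G.map x = y := by
  have hvirt : virtS k η x = G.JAinv y := by
    rw [virtS, hv, rd, stereoNorthInv_stereoNorthCoords hy.2]
  have hmem : virtS k η x ∈ G.LC := by rw [hvirt]; exact G.JAinv_mem hy.1
  exact ⟨⟨hx, G.not_mem_range_KC_of_virtS hmem⟩, by rw [G.map_eq_of_ne_zero hw, hvirt, G.JA_JAinv hy.1]⟩

end Gluing

end Readings

/-! ## A level point of a punctured collar is a guarded point of `M_k` -/

/-- In the inner annulus, a level point off the core satisfies the guards. [folklore] -/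
theorem mem_Mset_of_level_near {j : Fin k} {x : ℂ × ℂ}
    (hz : x.1 ∈ annulus (holeCentre k j) (1 / 2) (27 / 20)) (hw : x.2 ≠ 0)
    (hlev : planarPot k x.1 + ‖x.2‖ ^ 2 = 1) : x ∈ Mset k := by
  refine ⟨fun i ↦ ?_, hlev⟩
  by_cases hij : i = j
  · subst hij
    by_contra hlt
    push Not at hlt
    have h1 := one_le_planarPot_of_norm_le_one (ne_centre_of_mem_annulus (by norm_num) hz) hlt.le
    have hw2 : 0 < ‖x.2‖ ^ 2 := by positivity
    linarith
  · linarith [norm_sub_holeCentre_ge_of_near hz.2.le hij]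

/-- The level condition from the second component of `Θᴮ` being a unit vector. [folklore] -/
theorem level_of_norm_thetaB_snd {c : ℂ} {ĝ : ℂ → ℝ} {χ : ℝ → ℝ} {x : ℂ × ℂ} (hw : x.2 ≠ 0)
    (hg : 0 < ĝ x.1) (h : ‖(thetaB c ĝ χ x).2‖ = 1) : ĝ x.1 + ‖x.2‖ ^ 2 = 1 := by
  rw [thetaB] at h
  simp only at h
  rw [norm_mul, Complex.norm_real, norm_unitDir hw, mul_one, Real.norm_of_nonneg (by positivity)] at h
  exact h

/-! ## The section near the hole `c_j` -/

section Near

/-- The inner compression straightening map of the hole `c_j`. [folklore] -/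
def ΘBin (k : ℕ) (η : ℝ) (j : Fin k) : ℂ × ℂ → ℂ × ℂ :=
  thetaB (holeCentre k j) (planarPot k) (cutoff η)

/-- The punctured inner collar of the hole `c_j` (`|w| < 2`). [folklore] -/
def CBin (k : ℕ) (j : Fin k) : Set (ℂ × ℂ) := collarB (holeCentre k j) (1 / 2) (27 / 20) 2

/-- The image of the punctured inner collar is open and the inverse is smooth on it (`η > 0`).
[folklore] -/
theorem ΘBin_straighten (hη : 0 < η) (j : Fin k) :
    IsOpen (ΘBin k η j '' CBin k j) ∧
      ContDiffOn ℝ ∞ (invFunOn (ΘBin k η j) (CBin k j)) (ΘBin k η j '' CBin k j) :=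
  thetaB_straighten (le_refl _) (inner_smooth j) (inner_pos j) (inner_radial j) (contDiff_cutoff η)
    (deriv_cutoff_nonneg hη) (cutoff_nonneg η) (cutoff_le_one η) 2

variable {Y : Type*} [TopologicalSpace Y] [ChartedSpace (𝔼 3) Y] (G : Gluing k η Y)

namespace Gluing

/-- The virtual data read off `y`: `(chartZ, conj ∘ dir ∘ chartC)` of the reading. [folklore] -/
def vdata (y : Y) : ℂ × ℂ := (chartZ k (G.rd y), conj (dirC (G.rd y)))

/-- The open set about the images of the points near the hole `c_j`. [folklore] -/
def NNear (j : Fin k) : Set Y :=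
  (G.domRd ∩ G.rd ⁻¹' {y | chartC y ≠ 0}) ∩ G.vdata ⁻¹' (ΘBin k η j '' CBin k j)

/-- **The section near the hole `c_j`.** [folklore] -/
def secNear (j : Fin k) (y : Y) : ℂ × ℂ := invFunOn (ΘBin k η j) (CBin k j) (G.vdata y)

/-- `domRd ∩ rd⁻¹ {chartC ≠ 0}` is open. [folklore] -/
theorem isOpen_domRd' : IsOpen (G.domRd ∩ G.rd ⁻¹' {y | chartC y ≠ 0}) :=
  G.contMDiffOn_rd.continuousOn.isOpen_inter_preimage G.isOpen_domRd
    (isOpen_ne.preimage contDiff_chartC.continuous)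

/-- The virtual data are smooth on `domRd ∩ rd⁻¹ {chartC ≠ 0}`. [folklore] -/
theorem contMDiffOn_vdata :
    ContMDiffOn (𝓡 3) 𝓘(ℝ, ℂ × ℂ) ∞ G.vdata (G.domRd ∩ G.rd ⁻¹' {y | chartC y ≠ 0}) := by
  intro y hy
  have hrd : ContMDiffAt (𝓡 3) 𝓘(ℝ, (ℝ × ℝ) × ℝ) ∞ G.rd y :=
    (G.contMDiffOn_rd y hy.1).contMDiffAt (G.isOpen_domRd.mem_nhds hy.1)
  have h2 : ContDiffAt ℝ ∞ (fun y' : (ℝ × ℝ) × ℝ ↦ (chartZ k y', conj (dirC y'))) (G.rd y) :=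
    (contDiffAt_chartZ hy.2).prodMk (Complex.conjCLE.contDiff.comp_contDiffAt _ (contDiffAt_dirC hy.2))
  exact (h2.contMDiffAt.comp y hrd).contMDiffWithinAt

/-- `NNear j` is open. [folklore] -/
theorem isOpen_NNear (j : Fin k) : IsOpen (G.NNear j) :=
  G.contMDiffOn_vdata.continuousOn.isOpen_inter_preimage G.isOpen_domRd' (ΘBin_straighten G.hη j).1

/-- **The image of a point of `M_k ∖ K` off the cores near the hole `c_j` lies in `NNear j`.**
[folklore] -/
theorem map_mem_NNear {j : Fin k} {p : ℂ × ℂ} (hp : p ∈ G.Sset) (hw : p.2 ≠ 0)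
    (hz : p.1 ∈ annulus (holeCentre k j) (1 / 2) (27 / 20)) : G.map p ∈ G.NNear j := by
  obtain ⟨hdom, -, hrd⟩ := G.rd_map hp hw
  have hC : chartC (G.rd (G.map p)) ≠ 0 := by
    rw [hrd]; exact chartC_virtC_ne_zero G.hη G.hη' hp.1 hw
  refine ⟨⟨hdom, hC⟩, ?_⟩
  show G.vdata (G.map p) ∈ ΘBin k η j '' CBin k j
  have hv : G.vdata (G.map p) = ΘBin k η j p := by
    rw [vdata, hrd, chartZ_virtC G.hη G.hη' hp.1 hw, dirC_virtC G.hη G.hη' hp.1 hw,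
      Complex.conj_conj, ΘBin, thetaB_in_eq_of_near hp.1 hz]
  rw [hv]
  refine ⟨p, ⟨hz, hw, ?_⟩, rfl⟩
  have := hp.1.2
  have := inner_pos j _ hz
  nlinarith [norm_nonneg p.2]

/-- **The section near the hole `c_j` inverts the model map on `NNear j`** and lands in
`M_k ∖ K`. [folklore] -/
theorem secNear_spec {j : Fin k} {y : Y} (hy : y ∈ G.NNear j) :
    G.secNear j y ∈ G.Sset ∧ G.map (G.secNear j y) = y := by
  obtain ⟨⟨hdom, hC⟩, himg⟩ := hy
  have hC' : chartC (G.rd y) ≠ 0 := hC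
  set x := G.secNear j y with hx
  have hxmem : x ∈ CBin k j := invFunOn_thetaB_mem himg
  have hΘ : ΘBin k η j x = G.vdata y := thetaB_invFunOn himg
  obtain ⟨hz, hw, -⟩ := hxmem
  -- the level condition
  have hsnd : (ΘBin k η j x).2 = conj (dirC (G.rd y)) := by rw [hΘ]; rfl
  have hlev : planarPot k x.1 + ‖x.2‖ ^ 2 = 1 :=
    level_of_norm_thetaB_snd hw (inner_pos j _ hz)
      (by rw [ΘBin] at hsnd; rw [hsnd, Complex.norm_conj, norm_dirC hC'])
  have hM : x ∈ Mset k := mem_Mset_of_level_near hz hw hlev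
  refine G.map_eq_of_virtC_eq_rd ⟨hdom.1, hdom.2⟩ hM hw ?_
  -- the virtual chart point of `x` is the reading of `y`
  have hzmod : zmod k η x = chartZ k (G.rd y) := by
    rw [zmod_of_near hz]
    exact congrArg Prod.fst hΘ
  have hdir : conj (unitDir 0 x.2) = dirC (G.rd y) := by
    have h2 := thetaB_snd_of_level (c := holeCentre k j) (χ := cutoff η) hlev
    rw [← ΘBin, hsnd] at h2
    rw [← h2, Complex.conj_conj]
  rw [virtC, hzmod, hdir, cpt_chartZ_dirC]

/-- **The section near the hole `c_j` is smooth on `NNear j`.** [folklore] -/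
theorem contMDiffOn_secNear (j : Fin k) : ContMDiffOn (𝓡 3) 𝓘(ℝ, ℂ × ℂ) ∞ (G.secNear j) (G.NNear j) := by
  intro y hy
  have h1 : ContMDiffAt (𝓡 3) 𝓘(ℝ, ℂ × ℂ) ∞ G.vdata y :=
    (G.contMDiffOn_vdata y hy.1).contMDiffAt (G.isOpen_domRd'.mem_nhds hy.1)
  have h2 : ContMDiffAt 𝓘(ℝ, ℂ × ℂ) 𝓘(ℝ, ℂ × ℂ) ∞ (invFunOn (ΘBin k η j) (CBin k j)) (G.vdata y) :=
    ((ΘBin_straighten G.hη j).2.contMDiffOn.contMDiffAt ((ΘBin_straighten G.hη j).1.mem_nhds hy.2))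
  exact (h2.comp y h1).contMDiffWithinAt

end Gluing

end Near

/-! ## The section in the far zone -/

section Far

/-- The outer compression straightening map in the latitude coordinate. [folklore] -/
def ΘBout (k : ℕ) (η : ℝ) : ℂ × ℂ → ℂ × ℂ := thetaB 0 (outerPot k) (cutoff η)

/-- The punctured outer collar in the latitude coordinate (`|w| < 2`). [folklore] -/
def CBout (k : ℕ) : Set (ℂ × ℂ) := collarB 0 (latC k - 1 / 50) (latC k + 1 / 50) 2

/-- The image of the punctured outer collar is open and the inverse is smooth on it (`η > 0`).
[folklore] -/
theorem ΘBout_straighten (hη : 0 < η) :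
    IsOpen (ΘBout k η '' CBout k) ∧
      ContDiffOn ℝ ∞ (invFunOn (ΘBout k η) (CBout k)) (ΘBout k η '' CBout k) :=
  thetaB_straighten half_le_outer_a₁ outer_smooth outer_pos outer_radial (contDiff_cutoff η)
    (deriv_cutoff_nonneg hη) (cutoff_nonneg η) (cutoff_le_one η) 2

/-- The latitude is smooth. [folklore] -/
theorem contDiff_latS (k : ℕ) : ContDiff ℝ ∞ (latS k) := by
  have hre : ContDiff ℝ ∞ fun z : ℂ ↦ z.re := Complex.reCLM.contDiff
  have him : ContDiff ℝ ∞ fun z : ℂ ↦ z.im := Complex.imCLM.contDiff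
  have hden : ContDiff ℝ ∞ (outerDen k) := by
    unfold outerDen; exact ((hre.add contDiff_const).pow 2 |>.add (him.pow 2)).add contDiff_const
  unfold latS
  exact (contDiff_const.mul (hre.add contDiff_const)).div hden fun z ↦ (outerDen_pos z).ne'

variable {Y : Type*} [TopologicalSpace Y] [ChartedSpace (𝔼 3) Y] (G : Gluing k η Y)

namespace Gluing

/-- The virtual data read off `y` in the latitude coordinate. [folklore] -/
def vdataFar (y : Y) : ℂ × ℂ := (latCoord k (chartZ k (G.rd y)), conj (dirC (G.rd y)))

/-- The readable points whose `z`-reading is off the focus with positive latitude. [folklore] -/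
def domFar : Set Y :=
  (G.domRd ∩ G.rd ⁻¹' {y | chartC y ≠ 0}) ∩
    (fun y ↦ chartZ k (G.rd y)) ⁻¹' {ζ | coLat k ζ ≠ 0 ∧ 0 < latS k ζ}

/-- The open set about the images of the far points. [folklore] -/
def NFar : Set Y := G.domFar ∩ G.vdataFar ⁻¹' (ΘBout k η '' CBout k)

/-- **The section in the far zone.** [folklore] -/
def secFar (y : Y) : ℂ × ℂ :=
  (latCoordInv k (invFunOn (ΘBout k η) (CBout k) (G.vdataFar y)).1,
    (invFunOn (ΘBout k η) (CBout k) (G.vdataFar y)).2)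

/-- The `z`-reading is smooth on `domRd ∩ rd⁻¹ {chartC ≠ 0}`. [folklore] -/
theorem contMDiffOn_chartZ_rd :
    ContMDiffOn (𝓡 3) 𝓘(ℝ, ℂ) ∞ (fun y ↦ chartZ k (G.rd y)) (G.domRd ∩ G.rd ⁻¹' {y | chartC y ≠ 0}) := by
  intro y hy
  have hrd : ContMDiffAt (𝓡 3) 𝓘(ℝ, (ℝ × ℝ) × ℝ) ∞ G.rd y :=
    (G.contMDiffOn_rd y hy.1).contMDiffAt (G.isOpen_domRd.mem_nhds hy.1)
  exact ((contDiffAt_chartZ hy.2).contMDiffAt.comp y hrd).contMDiffWithinAt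

/-- `domFar` is open. [folklore] -/
theorem isOpen_domFar : IsOpen G.domFar :=
  G.contMDiffOn_chartZ_rd.continuousOn.isOpen_inter_preimage G.isOpen_domRd'
    ((isOpen_ne.preimage (contDiff_coLat k).continuous).inter
      (isOpen_lt continuous_const (contDiff_latS k).continuous))

/-- The latitude virtual data are smooth on `domFar`. [folklore] -/
theorem contMDiffOn_vdataFar : ContMDiffOn (𝓡 3) 𝓘(ℝ, ℂ × ℂ) ∞ G.vdataFar G.domFar := by
  intro y hy
  have hrd : ContMDiffAt (𝓡 3) 𝓘(ℝ, (ℝ × ℝ) × ℝ) ∞ G.rd y :=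
    (G.contMDiffOn_rd y hy.1.1).contMDiffAt (G.isOpen_domRd.mem_nhds hy.1.1)
  have hC : chartC (G.rd y) ≠ 0 := hy.1.2
  have h2 : ContDiffAt ℝ ∞ (fun y' : (ℝ × ℝ) × ℝ ↦ (latCoord k (chartZ k y'), conj (dirC y')))
      (G.rd y) :=
    ((contDiffAt_latCoord hy.2.1).comp _ (contDiffAt_chartZ hC)).prodMk
      (Complex.conjCLE.contDiff.comp_contDiffAt _ (contDiffAt_dirC hC))
  exact (h2.contMDiffAt.comp y hrd).contMDiffWithinAt

/-- `NFar` is open. [folklore] -/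
theorem isOpen_NFar : IsOpen G.NFar :=
  G.contMDiffOn_vdataFar.continuousOn.isOpen_inter_preimage G.isOpen_domFar (ΘBout_straighten G.hη).1

/-- **The image of a far point of `M_k ∖ K` off the cores with potential `≥ 19/20` lies in
`NFar`.** [folklore] -/
theorem map_mem_NFar {p : ℂ × ℂ} (hp : p ∈ G.Sset) (hw : p.2 ≠ 0)
    (hz : 20 * ((k : ℝ) + 1) ≤ ‖p.1‖) (hg : 19 / 20 ≤ planarPot k p.1) : G.map p ∈ G.NFar := by
  have hk : (0 : ℝ) ≤ k := Nat.cast_nonneg k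
  obtain ⟨hdom, -, hrd⟩ := G.rd_map hp hw
  have hC : chartC (G.rd (G.map p)) ≠ 0 := by
    rw [hrd]; exact chartC_virtC_ne_zero G.hη G.hη' hp.1 hw
  have hζ : chartZ k (G.rd (G.map p)) = zmod k η p := by rw [hrd, chartZ_virtC G.hη G.hη' hp.1 hw]
  have hzC := norm_fst_lt_drawRadius_of_mem hp.1
  have hco : coLat k p.1 ≠ 0 := coLat_ne_zero_of_lt_norm (by linarith) hzC
  have he : ‖coLatDir k p.1‖ = 1 := norm_coLatDir hco
  obtain ⟨hzmod, hF0⟩ := zmod_of_far_eq_outerZ (η := η) (by linarith) hzC hw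
  set F := cutoff η (planarPot k p.1) * thinRad ‖p.2‖ +
    (1 - cutoff η (planarPot k p.1)) * latS k p.1
  have hF1 : F < 1 := by
    have hχ0 := cutoff_nonneg η (planarPot k p.1)
    have hχ1 := cutoff_le_one η (planarPot k p.1)
    have hρ := thinRad_lt_half ‖p.2‖
    have hs1 := latS_lt_one_of_coLat_ne_zero hco
    show cutoff η (planarPot k p.1) * thinRad ‖p.2‖ +
      (1 - cutoff η (planarPot k p.1)) * latS k p.1 < 1
    rcases le_total (thinRad ‖p.2‖) (latS k p.1) with h | h
    · nlinarith [mul_nonneg hχ0 (sub_nonneg.2 h)]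
    · nlinarith [mul_nonneg (sub_nonneg.2 hχ1) (sub_nonneg.2 h)]
  refine ⟨⟨⟨hdom, hC⟩, ?_⟩, ?_⟩
  · show coLat k (chartZ k (G.rd (G.map p))) ≠ 0 ∧ 0 < latS k (chartZ k (G.rd (G.map p)))
    rw [hζ, hzmod, coLat_outerZ he hF0 hF1.le, latS_outerZ he hF0 hF1.le]
    exact ⟨smul_ne_zero (Real.sqrt_pos.2 (by nlinarith)).ne' (by
      rw [← norm_ne_zero_iff, he]; exact one_ne_zero), hF0⟩
  · show G.vdataFar (G.map p) ∈ ΘBout k η '' CBout k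
    have hv : G.vdataFar (G.map p) = ΘBout k η (latCoord k p.1, p.2) := by
      rw [vdataFar, hζ, hrd, dirC_virtC G.hη G.hη' hp.1 hw, Complex.conj_conj, ΘBout,
        thetaB_out_eq_of_far hp.1 (by linarith) hw]
    rw [hv]
    refine ⟨(latCoord k p.1, p.2), ⟨latCoord_mem_annulus_of_far hp.1 hz hg, hw, ?_⟩, rfl⟩
    show ‖p.2‖ < 2
    have := hp.1.2
    nlinarith [norm_nonneg p.2]

/-- **The far section inverts the model map on `NFar`** and lands in `M_k ∖ K`. [folklore] -/
theorem secFar_spec {y : Y} (hy : y ∈ G.NFar) : G.secFar y ∈ G.Sset ∧ G.map (G.secFar y) = y := by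
  obtain ⟨⟨⟨hdom, hC⟩, hco, hs⟩, himg⟩ := hy
  have hC' : chartC (G.rd y) ≠ 0 := hC
  set q := invFunOn (ΘBout k η) (CBout k) (G.vdataFar y) with hq
  have hqmem : q ∈ CBout k := invFunOn_thetaB_mem himg
  have hΘ : ΘBout k η q = G.vdataFar y := thetaB_invFunOn himg
  obtain ⟨hann, hqw, -⟩ := hqmem
  obtain ⟨hq0, hq0', hq1, hband⟩ := outer_annulus_bounds hann
  have hsnd : (ΘBout k η q).2 = conj (dirC (G.rd y)) := by rw [hΘ]; rfl
  have hlev : outerPot k q.1 + ‖q.2‖ ^ 2 = 1 :=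
    level_of_norm_thetaB_snd hqw (outer_pos _ hann)
      (by rw [ΘBout] at hsnd; rw [hsnd, Complex.norm_conj, norm_dirC hC'])
  -- the section point
  have hx1 : (G.secFar y).1 = latCoordInv k q.1 := rfl
  have hx2 : (G.secFar y).2 = q.2 := rfl
  have he : ‖toE2 (unitDir 0 q.1)‖ = 1 := by rw [norm_toE2, norm_unitDir hq0]
  have hfar : 29 * ((k : ℝ) + 1) ≤ ‖(G.secFar y).1‖ := by
    rw [hx1, latCoordInv]; exact le_norm_outerZ he hband
  have hk : (0 : ℝ) ≤ k := Nat.cast_nonneg k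
  have hM : G.secFar y ∈ Mset k := by
    refine ⟨fun i ↦ ?_, ?_⟩
    · rw [hx1, latCoordInv]
      have := norm_outerZ_sub_holeCentre_ge he hband i
      have h1 : (1 : ℝ) ≤ 25 * ((k : ℝ) + 1) := by linarith
      linarith
    · rw [hx1, hx2]; exact hlev
  refine G.map_eq_of_virtC_eq_rd ⟨hdom.1, hdom.2⟩ hM (by rw [hx2]; exact hqw) ?_
  have hΛ : latCoord k (G.secFar y).1 = q.1 := by rw [hx1, latCoord_latCoordInv hq0 hq1]
  have hzmod : zmod k η (G.secFar y) = chartZ k (G.rd y) := by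
    rw [zmod_of_far (by linarith)]
    change latCoordInv k (ΘBout k η (latCoord k (G.secFar y).1, (G.secFar y).2)).1 = _
    rw [hΛ, hx2, Prod.mk.eta, hΘ]
    show latCoordInv k (latCoord k (chartZ k (G.rd y))) = _
    rw [latCoordInv_latCoord hco hs]
  have hdir : conj (unitDir 0 (G.secFar y).2) = dirC (G.rd y) := by
    have h2 := thetaB_snd_of_level (c := (0 : ℂ)) (χ := cutoff η) hlev
    rw [← ΘBout, hsnd] at h2
    rw [hx2, ← h2, Complex.conj_conj]
  rw [virtC, hzmod, hdir, cpt_chartZ_dirC]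

/-- **The far section is smooth on `NFar`.** [folklore] -/
theorem contMDiffOn_secFar : ContMDiffOn (𝓡 3) 𝓘(ℝ, ℂ × ℂ) ∞ G.secFar G.NFar := by
  intro y hy
  have h1 : ContMDiffAt (𝓡 3) 𝓘(ℝ, ℂ × ℂ) ∞ G.vdataFar y :=
    (G.contMDiffOn_vdataFar y hy.1).contMDiffAt (G.isOpen_domFar.mem_nhds hy.1)
  have h2 : ContMDiffAt 𝓘(ℝ, ℂ × ℂ) 𝓘(ℝ, ℂ × ℂ) ∞ (invFunOn (ΘBout k η) (CBout k)) (G.vdataFar y) :=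
    ((ΘBout_straighten G.hη).2.contMDiffOn.contMDiffAt ((ΘBout_straighten G.hη).1.mem_nhds hy.2))
  have hqmem : invFunOn (ΘBout k η) (CBout k) (G.vdataFar y) ∈ CBout k := invFunOn_thetaB_mem hy.2
  obtain ⟨hq0, -, hq1, -⟩ := outer_annulus_bounds hqmem.1
  have h3 : ContDiffAt ℝ ∞ (fun q : ℂ × ℂ ↦ (latCoordInv k q.1, q.2))
      (invFunOn (ΘBout k η) (CBout k) (G.vdataFar y)) :=
    ((contDiffAt_latCoordInv hq0 hq1).comp _ contDiffAt_fst).prodMk contDiffAt_snd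
  exact (h3.contMDiffAt.comp y (h2.comp y h1)).contMDiffWithinAt

end Gluing

end Far

/-! ## The section at points of low potential: the chart lift -/

section Low

/-- **The model hypersurface in complex coordinates is the model boundary.** [folklore] -/
theorem mem_Mset_iff (x : 𝔼 4) : (zC x, wC x) ∈ Mset k ↔ x ∈ modelBoundary k := by
  simp only [Mset, modelBoundary, mem_setOf_eq, holeTerm_eq_normSq, levelFun_eq_planarPot_add,
    Complex.normSq_eq_norm_sq]
  refine and_congr (forall_congr' fun j ↦ ?_) Iff.rfl
  constructor
  · intro h; nlinarith [norm_nonneg (zC x - holeCentre k j)]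
  · intro h; nlinarith [norm_nonneg (zC x - holeCentre k j)]

variable {Y : Type*} [TopologicalSpace Y] [ChartedSpace (𝔼 3) Y] (G : Gluing k η Y)

namespace Gluing

/-- The open set about the images of the points of low potential. [folklore] -/
def NLow : Set Y :=
  G.domRd ∩ G.rd ⁻¹' (pictureRegion k ∩ (fun y ↦ chartZ k y) ⁻¹'
    {ζ | ‖ζ‖ < drawRadius k ∧ planarPot k ζ < 1 - 3 * η / 2})

/-- **The section at points of low potential**: the chart lift. [folklore] -/
def secLow (y : Y) : ℂ × ℂ := (zC (chartLift k (G.rd y)), wC (chartLift k (G.rd y)))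

/-- Points of the picture region read off the poles. [folklore] -/
theorem ne_holeCentre_of_mem_pictureRegion {y : (ℝ × ℝ) × ℝ} (hy : y ∈ pictureRegion k) (j : Fin k) :
    chartZ k y ≠ holeCentre k j := fun h ↦ by
  have := hy.2.1 j
  rw [h, sub_self, map_zero] at this
  linarith

/-- The target set of `NLow` in the chart is open. [folklore] -/
theorem isOpen_lowRegion : IsOpen (pictureRegion k ∩ (fun y ↦ chartZ k y) ⁻¹'
    {ζ : ℂ | ‖ζ‖ < drawRadius k ∧ planarPot k ζ < 1 - 3 * η / 2}) := by
  have hc : ContinuousOn (fun y : (ℝ × ℝ) × ℝ ↦ (‖chartZ k y‖, planarPot k (chartZ k y)))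
      (pictureRegion k) := fun y hy ↦
    (((contDiffAt_chartZ hy.1).continuousAt.norm).prodMk
      (((contDiffAt_planarPot (n := ∞) (ne_holeCentre_of_mem_pictureRegion hy)).continuousAt).comp
        (contDiffAt_chartZ hy.1).continuousAt)).continuousWithinAt
  have ho : IsOpen {b : ℝ × ℝ | b.1 < drawRadius k ∧ b.2 < 1 - 3 * η / 2} :=
    (isOpen_lt continuous_fst continuous_const).and (isOpen_lt continuous_snd continuous_const)
  exact hc.isOpen_inter_preimage isOpen_pictureRegion ho

/-- `NLow` is open. [folklore] -/
theorem isOpen_NLow : IsOpen G.NLow :=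
  G.contMDiffOn_rd.continuousOn.isOpen_inter_preimage G.isOpen_domRd isOpen_lowRegion

/-- **The image of a point of `M_k ∖ K` off the cores of potential `< 1 − 3η/2` lies in `NLow`.**
[folklore] -/
theorem map_mem_NLow {p : ℂ × ℂ} (hp : p ∈ G.Sset) (hw : p.2 ≠ 0)
    (hg : planarPot k p.1 < 1 - 3 * η / 2) : G.map p ∈ G.NLow := by
  obtain ⟨hdom, -, hrd⟩ := G.rd_map hp hw
  have hzC := norm_fst_lt_drawRadius_of_mem hp.1
  have hχ : cutoff η (planarPot k p.1) = 0 := cutoff_eq_zero G.hη hg.le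
  have hzmod : zmod k η p = p.1 := zmod_of_cutoff_eq_zero hχ hzC
  have hζ : chartZ k (virtC k η p) = p.1 := by rw [chartZ_virtC G.hη G.hη' hp.1 hw, hzmod]
  have hη := G.hη
  refine ⟨hdom, ?_⟩
  rw [mem_preimage, hrd]
  refine ⟨⟨chartC_virtC_ne_zero G.hη G.hη' hp.1 hw, fun j ↦ ?_, ?_⟩, ?_⟩
  · rw [hζ]
    have h1 := hp.1.1 j
    have hne : ‖p.1 - holeCentre k j‖ ≠ 1 := by
      intro h1eq
      have := one_le_planarPot_of_norm_le_one (ne_holeCentre_of_mem hp.1 j) h1eq.le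
      linarith
    have hgt : 1 < ‖p.1 - holeCentre k j‖ := lt_of_le_of_ne h1 (Ne.symm hne)
    rw [Complex.normSq_eq_norm_sq]; nlinarith
  · rw [hζ]; linarith
  · show ‖chartZ k (virtC k η p)‖ < drawRadius k ∧ planarPot k (chartZ k (virtC k η p)) < 1 - 3 * η / 2
    rw [hζ]; exact ⟨hzC, hg⟩

/-- **The low section inverts the model map on `NLow`** and lands in `M_k ∖ K`. [folklore] -/
theorem secLow_spec {y : Y} (hy : y ∈ G.NLow) : G.secLow y ∈ G.Sset ∧ G.map (G.secLow y) = y := by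
  obtain ⟨hdom, hreg, hζC, hg⟩ := hy
  have hM : G.secLow y ∈ Mset k := (mem_Mset_iff _).2 (chartLift_mem_modelBoundary hreg)
  have hw : (G.secLow y).2 ≠ 0 := wC_chartLift_ne_zero hreg
  refine G.map_eq_of_virtC_eq_rd hdom hM hw ?_
  have hz : (G.secLow y).1 = chartZ k (G.rd y) := zC_chartLift _
  have hzmod : zmod k η (G.secLow y) = (G.secLow y).1 :=
    zmod_of_cutoff_eq_zero (by rw [hz]; exact cutoff_eq_zero G.hη hg.le) (by rw [hz]; exact hζC)
  rw [virtC, hzmod]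
  show cpt k (zC (chartLift k (G.rd y))) (conj (unitDir 0 (wC (chartLift k (G.rd y))))) = G.rd y
  rw [← draw_eq_cpt, draw_chartLift hreg]

/-- **The low section is smooth on `NLow`.** [folklore] -/
theorem contMDiffOn_secLow : ContMDiffOn (𝓡 3) 𝓘(ℝ, ℂ × ℂ) ∞ G.secLow G.NLow := by
  intro y hy
  have hrd : ContMDiffAt (𝓡 3) 𝓘(ℝ, (ℝ × ℝ) × ℝ) ∞ G.rd y :=
    (G.contMDiffOn_rd y hy.1).contMDiffAt (G.isOpen_domRd.mem_nhds hy.1)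
  have h2 : ContDiffAt ℝ ∞ (fun y' : (ℝ × ℝ) × ℝ ↦ (zC (chartLift k y'), wC (chartLift k y'))) (G.rd y) :=
    (contDiff_zC.contDiffAt.comp _ (contDiffAt_chartLift hy.2.1)).prodMk
      (contDiff_wC.contDiffAt.comp _ (contDiffAt_chartLift hy.2.1))
  exact (h2.contMDiffAt.comp y hrd).contMDiffWithinAt

end Gluing

end Low

end MMSW

end Literature.Topology.FourManifolds
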